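import Literature.Probability.NegativeDependence.CNAImpliesHNLC
import Literature.Combinatorics.StablePolynomials.PartialSymmetrization
import Literature.Combinatorics.StablePolynomials.Limits
import Literature.MathematicalPhysics.QuantumLattice.LieTrotter
import Mathlib.Topology.Algebra.Module.FiniteDimension
import Mathlib.Analysis.Normed.Module.FiniteDimension
import HarnessLib

/-!
# The symmetric exclusion process preserves the strongly Rayleigh property
# (Borcea–Brändén–Liggett, §5: Proposition 5.1, Theorem 5.2 for finite `S`, Remark 5.1, (5.2)–(5.4))

J. Borcea, P. Brändén, T. M. Liggett, *Negative dependence and the geometry of polynomials*, J. Amer. Math. Soc.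
22 (2009) 521–567 (arXiv:0707.2340, held `paper:arxiv-0707.2340`; numbering of the arXiv version), §5. Verbatim
(arXiv pp. 21–22):

> (§5) Let `S` be a finite or countably infinite set and `p(x,y)` be the transition probabilities of a symmetric
> Markov chain on `S`, `q_{i,j} = q_{j,i}`. The symmetric exclusion process `η_t` on `{0,1}^S` is obtained by
> applying the transposition `τ_{i,j}` to `η` at the jump times of independent Poisson processes `N_{i,j}(t)` with
> rates `q_{i,j}`, indexed by unordered pairs `i, j`. We will denote probabilities for the process with initial
> configuration `η` by `P^η`. […] Proposition 1.7 of [L0] implies that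
> (5.2) `P^η(η_t ≡ 1 on A) ≤ Π_{i ∈ A} P^η(η_t(i) = 1)`, `A ⊆ S`.
> […] Inequality (5.2) was generalized by Andjel in [An] to
> (5.3) `P^η(η_t ≡ 1 on A ∪ B) ≤ P^η(η_t ≡ 1 on A) P^η(η_t ≡ 1 on B)`, `A, B ⊆ S`, `A ∩ B = ∅`.
> In that paper [L2], one of us conjectured that the distribution of `η_t` at time `t` with deterministic initial
> configuration `η` is negatively associated. Even the special case
> (5.4) `P^η(η_t ≡ 1 on A, η_t ≡ 0 on B) ≥ P^η(η_t ≡ 1 on A) P^η(η_t ≡ 0 on B)`, `A, B ⊆ S`, `A ∩ B = ∅`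
> remained open. […] We are now able to prove this conjecture, see Theorem 5.2 below.
>
> **Proposition 5.1.** Suppose that `S` is finite and the initial distribution `η_0` of a symmetric exclusion
> process on `{0,1}^S` is strongly Rayleigh. Then so is the distribution of `η_t` for all `t > 0`.
> *Proof.* First, we observe that it suffices to prove the statement in case `q_{i,j} ≠ 0` for only one pair
> `i, j`. To see this, suppose `T_1(t)` and `T_2(t)` are semigroups for finite state Markov chains on the same
> state space with generators `𝓛_1` and `𝓛_2` respectively, and let `T(t)` be the semigroup with generator
> `𝓛_1 + 𝓛_2`. The Trotter product formula (see [EK]) gives `T(t) = lim_{n → ∞} [T_1(t/n) T_2(t/n)]^n`. It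
> follows that if a closed set of probability measures `𝓜` on the state space has the property that `μ ∈ 𝓜`
> implies `μ T_i(t) ∈ 𝓜` for `i = 1, 2` and `t > 0`, then `μ ∈ 𝓜` implies `μ T(t) ∈ 𝓜` for `t > 0`. Now write
> the generator of the symmetric exclusion process as the following sum, corresponding to transitions at
> individual pairs of sites: `𝓛 = Σ_{i,j} 𝓛_{i,j}`, where `𝓛_{i,j} F(η) = ½ q_{i,j} [F(τ_{i,j}(η)) - F(η)]`.
> Repeated application of the preceding observation with `𝓜 =` the strongly Rayleigh measures completes the
> reduction. In the case of a single non-zero `q_{i,j}`, the generating polynomial of the distribution of `η_t` is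
> given by `α f(z) + (1 - α) f(τ_{i,j}(z))`, where `α = P(N_{i,j}(t) is even)` and `f` is the generating
> polynomial for the initial distribution. Therefore, the result follows from Theorem 4.20. □
>
> (§2.2, before Def. 2.11) Note that this property [strongly Rayleigh] is preserved by weak convergence of
> measures.
>
> **Theorem 5.2.** Suppose that `S` is countable and the initial distribution `η_0` of a symmetric exclusion
> process on `{0,1}^S` is strongly Rayleigh. Then the distribution of `η_t` is strongly Rayleigh, and hence CNA+,
> for all `t > 0`. *Proof.* Since stability (the strongly Rayleigh property) implies negative association by
> Theorem 4.9, the result follows from Proposition 5.1 when `S` is finite. […]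
>
> **Remark 5.1.** In particular, Theorem 5.2 proves Conjecture (5.4) and shows that its conclusion remains valid
> if the initial configuration is a product measure (since any such measure is obviously strongly Rayleigh).

## Transposition (vocabulary of the sibling files) and the one deviation from the printed proof

* Measures on `{0,1}^S`, `S = σ` a finite type, are (unnormalised) weights `μ : Finset σ → ℝ` on subsets
  (`η ↦ {i : η(i) = 1}`); "strongly Rayleigh" is the tree's `StableOrZero` (`StronglyRayleighNegativeAssociation`),
  CNA+ / NA are `IsCNAPlus` / `IsNegAssoc` (`NegativeAssociationHierarchy`), expectations `ex`, total mass `mass`.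
* The generator acts on weights by the same formula as on functions (the chain is symmetric, `τ_{i,j}` is an
  involution): `(μ𝓛)(S) = Σ_{i,j} ½ q_{i,j} [μ(τ_{i,j} S) - μ(S)]` (`excGen`, sum over ordered pairs as printed); the
  distribution of `η_t` when `η_0 ∼ μ` is `μ T(t)`, `T(t) = e^{t𝓛}` — here BY DEFINITION `sepLaw q t μ :=
  exp (t • excGen q) μ` (the transition semigroup of a finite-state chain is the matrix exponential of its
  generator); §5 proves the semigroup law and the Kolmogorov forward equation `d/dt μ_t = μ_t 𝓛` for it.
* THE DEVIATION. BBL reduce to one pair by the Trotter product formula and treat one pair through the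
  semigroup `T_{i,j}(t) = α + (1 - α) τ_{i,j}`, `α = P(N_{i,j}(t) even)`, a partial symmetrization (Thm. 4.20). We
  use instead the EULER product formula `e^{t𝓛} = lim_N [Π_{(i,j)} (1 + (t/N) 𝓛_{i,j})]^N` (proved in §1 in any
  Banach algebra, with rate, from the tree's Lie–Trotter toolbox `QuantumLattice/LieTrotter`): each Euler factor
  `1 + (t/N) 𝓛_{i,j} = (1 - θ) + θ τ_{i,j}`, `θ = t q_{i,j} / (2N) ∈ [0,1]` for `N` large, IS the partial
  symmetrization `μ ↦ μ^{τ,1-θ}` of Thm. 4.20 (tree `IsUpperHalfPlaneStable.partialSymmetrization`,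
  `StablePolynomials/PartialSymmetrization`), so BBL's sentence "if a closed set `𝓜` is preserved by each
  `T_i(t)` then it is preserved by `T(t)`" is proved in the form "if a closed set `𝓜` is preserved by every
  partial symmetrization then it is preserved by `T(t)`" (`sepLaw_mem_of_isClosed`), and the one-pair
  computation of `α` is not needed. Closedness of the strongly Rayleigh class (§2.2 "preserved by weak
  convergence") is the tree's multivariate Hurwitz theorem `eq_zero_or_isUpperHalfPlaneStable_of_tendsto_coeff`
  (`StablePolynomials/Limits`).
* Theorem 5.2 is formalized for finite `S` only. -- TODO(general form): countable `S` (projective limits of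
  measures on `{0,1}^S`, Trotter–Kurtz) is not formalized; nor is (III) (`μ_α` is NA) which needs `t → ∞` on
  infinite `S`.

## Contents (namespace `Literature.Probability.NegativeDependence`)

* §1 Euler product formula in a Banach algebra: `norm_prod_one_add_le`, `norm_prod_one_add_sub_one_le`,
  `norm_prod_one_add_sub_one_sub_sum_le`, `norm_prod_one_add_sub_exp_sum_le`,
  **`norm_eulerProduct_pow_sub_exp_le`** (rate `2 S² e^{2S} / N`), **`tendsto_eulerProduct_pow`**.
* §2 Closed invariant classes: `mapsTo_list_prod`, `mapsTo_pow`, **`mapsTo_exp_smul_sum_of_isClosed`** (BBL's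
  "closed set preserved by the factors is preserved by `T(t)`", Euler form).
* §3 **`StableOrZero.of_tendsto`**, **`isClosed_setOf_stableOrZero`** (§2.2: strongly Rayleigh is weakly closed).
* §4 Transpositions of weights: `swapWeight`, `partialSymmWeight θ a b μ = θμ + (1-θ)τ_{a,b}(μ)` (Def. of
  `μ^{τ,θ}`, §4.3), `multiAffine_swapWeight`, **`stableOrZero_partialSymmWeight`** (Thm. 4.20 for weights),
  `mass_partialSymmWeight`, `partialSymmWeight_nonneg`.
* §5 The process: `swapOp`, `pairGen` (`𝓛_{i,j}`), `excGen` (`𝓛`), `sepLaw` (`μ T(t)`); `sepLaw_zero`,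
  `sepLaw_add` (semigroup), `hasDerivAt_sepLaw` (forward equation), **`sepLaw_mem_of_isClosed`**,
  `sepLaw_nonneg`, `mass_sepLaw`.
* §6 **`stableOrZero_sepLaw`** (= **Proposition 5.1**), **`isCNAPlus_sepLaw`**, `isNegAssoc_sepLaw`
  (= **Theorem 5.2**, finite `S`), `stableOrZero_dirac`, `productWeight`/`stableOrZero_productWeight`
  (Remark 5.1: deterministic and product initial configurations), **`BorceaBrandenLiggett_eq_5_4`** (Liggett's
  conjecture (5.4)), `BorceaBrandenLiggett_eq_5_3` (Andjel's inequality (5.3)), `BorceaBrandenLiggett_eq_5_2`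
  (Liggett's (5.2)).

No `sorry`, no named fact, no instance/notation; definitions with bodies.

## References

* [BorceaBrandenLiggett2007] J. Borcea, P. Brändén, T. M. Liggett, Negative dependence and the geometry of
  polynomials, J. Amer. Math. Soc. 22 (2009) 521–567; arXiv:0707.2340 — §5 Prop. 5.1, Thm. 5.2, Remark 5.1,
  (5.2)–(5.4); §4.3 Thm. 4.20; §2.2.
* [Liggett1985] T. M. Liggett, Interacting Particle Systems, Springer 1985 — Ch. VIII (the symmetric exclusion
  process; Prop. 1.7 = (5.2)).
* [Andjel1988] E. D. Andjel, A correlation inequality for the symmetric exclusion process, Ann. Probab. 16 (1988)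
  717–721 — (5.3).
* [ReedSimonI1980] M. Reed, B. Simon, Methods of Modern Mathematical Physics I, Thm. VIII.29 (Lie product
  formula; the telescoping estimate reused in §1).
* [EthierKurtz1986] S. N. Ethier, T. G. Kurtz, Markov Processes, Wiley 1986 — the Trotter product formula cited
  as [EK].
-/

noncomputable section

open Finset Filter Topology NormedSpace
open Literature.Combinatorics.Sahi2008
open Literature.Combinatorics.StablePolynomials
open Literature.MathematicalPhysics.QuantumLattice

namespace Literature.Probability.NegativeDependence

/-! ## §1 The Euler product formula `[Π_k (1 + a_k/N)]^N → exp (Σ_k a_k)` in a Banach algebra -/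

section EulerProduct

variable {𝔸 : Type*} [NormedRing 𝔸] [NormOneClass 𝔸]

omit [NormOneClass 𝔸] in
/-- `‖Σ_k x_k‖ ≤ Σ_k ‖x_k‖` for a list. [folklore] -/
private theorem norm_list_sum_le_sum (l : List 𝔸) : ‖l.sum‖ ≤ (l.map (‖·‖)).sum := by
  induction l with
  | nil => simp
  | cons x l ih =>
    rw [List.sum_cons, List.map_cons, List.sum_cons]
    exact (norm_add_le _ _).trans (by gcongr)

omit [NormOneClass 𝔸] in
/-- `0 ≤ Σ_k ‖x_k‖`. [folklore] -/
private theorem sum_norm_nonneg (l : List 𝔸) : 0 ≤ (l.map (‖·‖)).sum := by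
  induction l with
  | nil => simp
  | cons x l ih =>
    rw [List.map_cons, List.sum_cons]
    positivity

/-- `‖Π_k (1 + x_k)‖ ≤ e^{Σ_k ‖x_k‖}` (since `1 + s ≤ e^s`). Reed–Simon I, proof of Thm. VIII.29 (norm bounds
for product approximants). [cite: ReedSimonI1980, Theorem VIII.29 (proof)] -/
theorem norm_prod_one_add_le (l : List 𝔸) :
    ‖(l.map fun x => 1 + x).prod‖ ≤ Real.exp (l.map (‖·‖)).sum := by
  induction l with
  | nil => simp
  | cons x l ih =>
    rw [List.map_cons, List.prod_cons, List.map_cons, List.sum_cons, Real.exp_add]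
    have h1 : ‖(1 : 𝔸) + x‖ ≤ ‖x‖ + 1 := (norm_add_le _ _).trans (by rw [norm_one, add_comm])
    calc ‖(1 + x) * (l.map fun x => 1 + x).prod‖
        ≤ ‖1 + x‖ * ‖(l.map fun x => 1 + x).prod‖ := norm_mul_le _ _
      _ ≤ (‖x‖ + 1) * Real.exp (l.map (‖·‖)).sum :=
          mul_le_mul h1 ih (norm_nonneg _) (by positivity)
      _ ≤ Real.exp ‖x‖ * Real.exp (l.map (‖·‖)).sum :=
          mul_le_mul_of_nonneg_right (Real.add_one_le_exp _) (Real.exp_nonneg _)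

/-- `‖Π_k (1 + x_k) - 1‖ ≤ s e^s`, `s = Σ_k ‖x_k‖` (first-order remainder of the product). Reed–Simon I,
proof of Thm. VIII.29. [cite: ReedSimonI1980, Theorem VIII.29 (proof)] -/
theorem norm_prod_one_add_sub_one_le (l : List 𝔸) :
    ‖(l.map fun x => 1 + x).prod - 1‖ ≤ (l.map (‖·‖)).sum * Real.exp (l.map (‖·‖)).sum := by
  induction l with
  | nil => simp
  | cons x l ih =>
    have hs' := sum_norm_nonneg l
    rw [List.map_cons, List.prod_cons, List.map_cons, List.sum_cons]
    set P := (l.map fun x => 1 + x).prod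
    set s' := (l.map (‖·‖)).sum
    have key : (1 + x) * P - 1 = x * P + (P - 1) := by noncomm_ring
    rw [key]
    calc ‖x * P + (P - 1)‖ ≤ ‖x * P‖ + ‖P - 1‖ := norm_add_le _ _
      _ ≤ ‖x‖ * ‖P‖ + ‖P - 1‖ := add_le_add (norm_mul_le _ _) le_rfl
      _ ≤ ‖x‖ * Real.exp s' + s' * Real.exp s' :=
          add_le_add (mul_le_mul_of_nonneg_left (norm_prod_one_add_le l) (norm_nonneg _)) ih
      _ = (‖x‖ + s') * Real.exp s' := by ring
      _ ≤ (‖x‖ + s') * Real.exp (‖x‖ + s') :=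
          mul_le_mul_of_nonneg_left (Real.exp_le_exp.2 (le_add_of_nonneg_left (norm_nonneg _)))
            (add_nonneg (norm_nonneg _) hs')

/-- `‖Π_k (1 + x_k) - 1 - Σ_k x_k‖ ≤ s² e^s`, `s = Σ_k ‖x_k‖` (second-order remainder of the product).
Reed–Simon I, proof of Thm. VIII.29. [cite: ReedSimonI1980, Theorem VIII.29 (proof)] -/
theorem norm_prod_one_add_sub_one_sub_sum_le (l : List 𝔸) :
    ‖(l.map fun x => 1 + x).prod - 1 - l.sum‖ ≤ (l.map (‖·‖)).sum ^ 2 * Real.exp (l.map (‖·‖)).sum := by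
  induction l with
  | nil => simp
  | cons x l ih =>
    have hs' := sum_norm_nonneg l
    rw [List.map_cons, List.prod_cons, List.sum_cons, List.map_cons, List.sum_cons]
    set P := (l.map fun x => 1 + x).prod
    set s' := (l.map (‖·‖)).sum
    have key : (1 + x) * P - 1 - (x + l.sum) = (P - 1 - l.sum) + x * (P - 1) := by noncomm_ring
    rw [key]
    have hx := norm_nonneg x
    calc ‖P - 1 - l.sum + x * (P - 1)‖ ≤ ‖P - 1 - l.sum‖ + ‖x * (P - 1)‖ := norm_add_le _ _
      _ ≤ ‖P - 1 - l.sum‖ + ‖x‖ * ‖P - 1‖ := add_le_add le_rfl (norm_mul_le _ _)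
      _ ≤ s' ^ 2 * Real.exp s' + ‖x‖ * (s' * Real.exp s') :=
          add_le_add ih (mul_le_mul_of_nonneg_left (norm_prod_one_add_sub_one_le l) hx)
      _ = (‖x‖ + s') * s' * Real.exp s' := by ring
      _ ≤ (‖x‖ + s') * (‖x‖ + s') * Real.exp (‖x‖ + s') :=
          mul_le_mul (mul_le_mul_of_nonneg_left (le_add_of_nonneg_left hx) (add_nonneg hx hs'))
            (Real.exp_le_exp.2 (le_add_of_nonneg_left hx)) (Real.exp_nonneg _)
            (mul_nonneg (add_nonneg hx hs') (add_nonneg hx hs'))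
      _ = (‖x‖ + s') ^ 2 * Real.exp (‖x‖ + s') := by ring

variable (𝕂 : Type*) [RCLike 𝕂] [NormedAlgebra 𝕂 𝔸] [CompleteSpace 𝔸]

include 𝕂 in
/-- `‖Π_k (1 + x_k) - exp (Σ_k x_k)‖ ≤ 2 s² e^s`, `s = Σ_k ‖x_k‖`: the Euler factor `Π (1 + x_k)` and
`exp (Σ x_k)` agree to second order. Reed–Simon I, proof of Thm. VIII.29 (with the tree's
`norm_exp_sub_one_sub_le`). [cite: ReedSimonI1980, Theorem VIII.29 (proof)] -/
theorem norm_prod_one_add_sub_exp_sum_le (l : List 𝔸) :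
    ‖(l.map fun x => 1 + x).prod - exp l.sum‖ ≤
      2 * (l.map (‖·‖)).sum ^ 2 * Real.exp (l.map (‖·‖)).sum := by
  set s := (l.map (‖·‖)).sum
  have hs : 0 ≤ s := sum_norm_nonneg l
  have hsum0 : ‖l.sum‖ ≤ s := norm_list_sum_le_sum l
  have key : (l.map fun x => 1 + x).prod - exp l.sum =
      ((l.map fun x => 1 + x).prod - 1 - l.sum) - (exp l.sum - 1 - l.sum) := by abel
  rw [key]
  calc ‖(l.map fun x => 1 + x).prod - 1 - l.sum - (exp l.sum - 1 - l.sum)‖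
      ≤ ‖(l.map fun x => 1 + x).prod - 1 - l.sum‖ + ‖exp l.sum - 1 - l.sum‖ := norm_sub_le _ _
    _ ≤ s ^ 2 * Real.exp s + ‖l.sum‖ ^ 2 * Real.exp ‖l.sum‖ :=
        add_le_add (norm_prod_one_add_sub_one_sub_sum_le l) (norm_exp_sub_one_sub_le 𝕂 l.sum)
    _ ≤ s ^ 2 * Real.exp s + s ^ 2 * Real.exp s := by gcongr
    _ = 2 * s ^ 2 * Real.exp s := by ring

omit [NormOneClass 𝔸] [CompleteSpace 𝔸] in
/-- The scaled list `(a_k / N)_k` has `Σ_k ‖a_k/N‖ = (Σ_k ‖a_k‖)/N`. [folklore] -/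
private theorem sum_norm_map_smul (l : List 𝔸) (N : ℕ) :
    ((l.map fun a => (N : 𝕂)⁻¹ • a).map (‖·‖)).sum = (l.map (‖·‖)).sum / N := by
  rw [List.map_map, div_eq_inv_mul, ← List.sum_map_mul_left]
  congr 1
  refine List.map_congr_left fun a _ => ?_
  simp only [Function.comp_apply, norm_smul, norm_inv, RCLike.norm_natCast]

variable {𝕂}

/-- **Euler product formula with rate.** In a Banach algebra with `‖1‖ = 1`, for `N ≥ 1` and a finite list
`a_1, …, a_m`: `‖[Π_k (1 + a_k/N)]^N - exp (Σ_k a_k)‖ ≤ 2 S² e^{2S} / N`, `S = Σ_k ‖a_k‖`. Proof as for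
the Lie product formula: with `X = Π_k (1 + a_k/N)`, `Y = exp ((Σ a_k)/N)` one has `Y^N = exp (Σ a_k)`,
`‖X‖, ‖Y‖ ≤ e^{S/N}`, `‖X - Y‖ ≤ 2 (S/N)² e^{S/N}`, and the telescoping estimate `norm_pow_sub_pow_le'`.
(Used below in place of the Trotter product formula of BBL §5.) [cite: ReedSimonI1980, Theorem VIII.29]
[cite: BorceaBrandenLiggett2007, §5 proof of Prop. 5.1 ("The Trotter product formula (see [EK]) gives
`T(t) = lim [T_1(t/n) T_2(t/n)]^n`")] -/
theorem norm_eulerProduct_pow_sub_exp_le (l : List 𝔸) {N : ℕ} (hN : N ≠ 0) :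
    ‖((l.map fun a => 1 + (N : 𝕂)⁻¹ • a).prod) ^ N - exp l.sum‖ ≤
      2 * (l.map (‖·‖)).sum ^ 2 * Real.exp (2 * (l.map (‖·‖)).sum) / N := by
  letI : NormedAlgebra ℚ 𝔸 := NormedAlgebra.restrictScalars ℚ 𝕂 𝔸
  obtain ⟨n, rfl⟩ : ∃ n, N = n + 1 := Nat.exists_eq_succ_of_ne_zero hN
  set S : ℝ := (l.map (‖·‖)).sum with hS_def
  have hS0 : 0 ≤ S := sum_norm_nonneg l
  have hNpos : (0 : ℝ) < (n + 1 : ℕ) := by positivity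
  set l' : List 𝔸 := l.map fun a => ((n + 1 : ℕ) : 𝕂)⁻¹ • a with hl'_def
  have hl'sum : l'.sum = ((n + 1 : ℕ) : 𝕂)⁻¹ • l.sum := by rw [hl'_def, ← List.smul_sum]
  have hl'norm : (l'.map (‖·‖)).sum = S / (n + 1 : ℕ) := sum_norm_map_smul 𝕂 l (n + 1)
  have hprod : (l.map fun a => 1 + ((n + 1 : ℕ) : 𝕂)⁻¹ • a).prod = (l'.map fun x => 1 + x).prod := by
    rw [hl'_def, List.map_map]; rfl
  set X : 𝔸 := (l'.map fun x => 1 + x).prod with hX_def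
  set Y : 𝔸 := exp l'.sum with hY_def
  -- `Y^N = exp (Σ a_k)`
  have hYN : Y ^ (n + 1) = exp l.sum := by
    rw [hY_def, ← exp_nsmul, hl'sum, ← Nat.cast_smul_eq_nsmul 𝕂, smul_smul,
      mul_inv_cancel₀ (by exact_mod_cast hN), one_smul]
  -- norms of `X`, `Y`
  set M : ℝ := Real.exp (S / (n + 1 : ℕ)) with hM_def
  have hXM : ‖X‖ ≤ M := by
    rw [hM_def, ← hl'norm]; exact norm_prod_one_add_le l'
  have hsumS : ‖l'.sum‖ ≤ S / (n + 1 : ℕ) := by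
    rw [← hl'norm]; exact norm_list_sum_le_sum l'
  have hYM : ‖Y‖ ≤ M :=
    calc ‖Y‖ ≤ Real.exp ‖l'.sum‖ := norm_exp_le 𝕂 l'.sum
      _ ≤ M := Real.exp_le_exp.mpr hsumS
  have hMn : M ^ n ≤ Real.exp S := by
    rw [hM_def, ← Real.exp_nat_mul]
    apply Real.exp_le_exp.mpr
    have h1 : (n : ℝ) * (S / (n + 1 : ℕ)) = S * (n / (n + 1 : ℕ)) := by ring
    rw [h1]
    apply mul_le_of_le_one_right hS0
    rw [div_le_one hNpos]
    exact_mod_cast Nat.le_succ n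
  have hM1 : M ≤ Real.exp S := by
    rw [hM_def]
    exact Real.exp_le_exp.mpr (div_le_self hS0 (by exact_mod_cast Nat.succ_pos n))
  -- the one-step estimate
  have hd : ‖X - Y‖ ≤ 2 * (S / (n + 1 : ℕ)) ^ 2 * Real.exp S :=
    calc ‖X - Y‖ ≤ 2 * (l'.map (‖·‖)).sum ^ 2 * Real.exp (l'.map (‖·‖)).sum :=
          norm_prod_one_add_sub_exp_sum_le 𝕂 l'
      _ = 2 * (S / (n + 1 : ℕ)) ^ 2 * M := by rw [hl'norm]
      _ ≤ 2 * (S / (n + 1 : ℕ)) ^ 2 * Real.exp S := by gcongr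
  -- telescoping
  have htel := norm_pow_sub_pow_le' X Y hXM hYM n
  rw [hYN] at htel
  have h2 : Real.exp S * Real.exp S = Real.exp (2 * S) := by
    rw [← Real.exp_add]; ring_nf
  rw [hprod]
  calc ‖X ^ (n + 1) - exp l.sum‖ ≤ (n + 1) * M ^ n * ‖X - Y‖ := htel
    _ ≤ (n + 1) * Real.exp S * (2 * (S / (n + 1 : ℕ)) ^ 2 * Real.exp S) := by
        gcongr
    _ = 2 * S ^ 2 * Real.exp (2 * S) / (n + 1 : ℕ) := by
        rw [← h2]
        field_simp
        push_cast
        ring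

/-- **Euler product formula**: `[Π_k (1 + a_k/N)]^N → exp (Σ_k a_k)` as `N → ∞`, in any Banach algebra with
`‖1‖ = 1` (the `a_k` need not commute). [cite: ReedSimonI1980, Theorem VIII.29]
[cite: BorceaBrandenLiggett2007, §5 proof of Prop. 5.1 (product formula for `T(t)`)] -/
theorem tendsto_eulerProduct_pow (l : List 𝔸) :
    Tendsto (fun N : ℕ => ((l.map fun a => 1 + (N : 𝕂)⁻¹ • a).prod) ^ N) atTop (𝓝 (exp l.sum)) := by
  set C : ℝ := 2 * (l.map (‖·‖)).sum ^ 2 * Real.exp (2 * (l.map (‖·‖)).sum)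
  rw [tendsto_iff_norm_sub_tendsto_zero]
  refine squeeze_zero_norm' ?_ (tendsto_const_div_atTop_nhds_zero_nat C)
  filter_upwards [eventually_ne_atTop 0] with N hN
  rw [Real.norm_of_nonneg (norm_nonneg _)]
  exact norm_eulerProduct_pow_sub_exp_le (𝕂 := 𝕂) l hN

end EulerProduct

/-! ## §2 Closed classes preserved by the Euler factors are preserved by `exp (t Σ_k L_k)` -/

section Invariance

variable {V : Type*} [NormedAddCommGroup V] [NormedSpace ℝ V]

/-- A product (composite) of operators each mapping `M` into itself maps `M` into itself ("repeated application of
the preceding observation"). [cite: BorceaBrandenLiggett2007, §5 proof of Prop. 5.1] -/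
theorem mapsTo_list_prod {M : Set V} {l : List (V →L[ℝ] V)} (h : ∀ L ∈ l, Set.MapsTo L M M) :
    Set.MapsTo (l.prod : V →L[ℝ] V) M M := by
  induction l with
  | nil => intro v hv; simpa using hv
  | cons L l ih =>
    intro v hv
    rw [List.prod_cons, mul_apply_eq_comp]
    exact h L (by simp) (ih (fun L' hL' => h L' (by simp [hL'])) hv)

/-- Powers of an operator mapping `M` into itself map `M` into itself (the `n`-th power in
`[T_1(t/n) T_2(t/n)]^n`). [cite: BorceaBrandenLiggett2007, §5 proof of Prop. 5.1] -/
theorem mapsTo_pow {M : Set V} {A : V →L[ℝ] V} (h : Set.MapsTo A M M) (N : ℕ) :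
    Set.MapsTo (A ^ N : V →L[ℝ] V) M M := by
  induction N with
  | zero => intro v hv; simpa using hv
  | succ N ih =>
    intro v hv
    rw [pow_succ, mul_apply_eq_comp]
    exact ih (h hv)

variable [CompleteSpace V]

/-- **"If a closed set `𝓜` is preserved by each factor then it is preserved by `T(t)`"** (BBL §5, proof of
Prop. 5.1), in Euler form: if `M` is closed and every Euler step `1 + s L_k`, `0 ≤ s ≤ ε`, maps `M` into `M`,
then so does `exp (t Σ_k L_k)` for every `t ≥ 0` — because `exp (t Σ L_k) = lim_N [Π_k (1 + (t/N) L_k)]^N`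
(`tendsto_eulerProduct_pow`). [cite: BorceaBrandenLiggett2007, §5 proof of Prop. 5.1] -/
theorem mapsTo_exp_smul_sum_of_isClosed {M : Set V} (hM : IsClosed M) (l : List (V →L[ℝ] V)) {ε : ℝ}
    (hε : 0 < ε) (h : ∀ L ∈ l, ∀ s : ℝ, 0 ≤ s → s ≤ ε → Set.MapsTo (1 + s • L : V →L[ℝ] V) M M) {t : ℝ}
    (ht : 0 ≤ t) : Set.MapsTo (exp (t • l.sum) : V →L[ℝ] V) M M := by
  intro v hv
  rcases subsingleton_or_nontrivial V with hV | hV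
  · rw [Subsingleton.elim ((exp (t • l.sum) : V →L[ℝ] V) v) v]; exact hv
  -- the Euler approximants
  set A : ℕ → (V →L[ℝ] V) := fun N => (((l.map fun L => t • L).map fun a => 1 + (N : ℝ)⁻¹ • a).prod) ^ N
    with hA_def
  have hlim : Tendsto A atTop (𝓝 (exp (t • l.sum))) := by
    have h1 := tendsto_eulerProduct_pow (𝕂 := ℝ) (l.map fun L => t • L)
    rwa [← List.smul_sum] at h1
  have hlimv : Tendsto (fun N => A N v) atTop (𝓝 ((exp (t • l.sum) : V →L[ℝ] V) v)) := by
    have h := ((ContinuousLinearMap.apply ℝ V v).continuous.tendsto _).comp hlim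
    simpa [Function.comp_def] using h
  -- eventually every factor is an admissible Euler step
  have hev : ∀ᶠ N : ℕ in atTop, (N : ℝ)⁻¹ * t ≤ ε := by
    have h0 : Tendsto (fun N : ℕ => (N : ℝ)⁻¹ * t) atTop (𝓝 0) := by
      simpa [div_eq_inv_mul] using tendsto_const_div_atTop_nhds_zero_nat t
    exact h0.eventually (eventually_le_nhds hε)
  have hmem : ∀ᶠ N : ℕ in atTop, A N v ∈ M := by
    filter_upwards [hev] with N hN
    refine mapsTo_pow (mapsTo_list_prod fun L' hL' => ?_) N hv
    rw [List.map_map] at hL'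
    obtain ⟨L, hL, rfl⟩ := List.mem_map.1 hL'
    have hs : (1 : V →L[ℝ] V) + (N : ℝ)⁻¹ • (t • L) = 1 + ((N : ℝ)⁻¹ * t) • L := by
      rw [smul_smul]
    simp only [Function.comp_apply]
    rw [hs]
    exact h L hL _ (mul_nonneg (inv_nonneg.2 (Nat.cast_nonneg N)) ht) hN
  exact hM.mem_of_tendsto hlimv hmem

end Invariance

/-! ## §3 The strongly Rayleigh class is closed (BBL §2.2: "preserved by weak convergence of measures") -/

section Closed

variable {σ : Type*} [Fintype σ]

/-- The exponents of `Σ_S a(S) z^S` are indicator vectors `𝟙_S`. [folklore] -/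
private theorem support_multiAffine_subset [DecidableEq σ] (a : Finset σ → ℂ) :
    (multiAffine a).support ⊆
      (univ : Finset (Finset σ)).image fun S => ∑ i ∈ S, Finsupp.single i 1 := by
  intro m hm
  rw [MvPolynomial.mem_support_iff, coeff_multiAffine] at hm
  obtain ⟨S, -, hS⟩ := Finset.exists_ne_zero_of_sum_ne_zero hm
  by_cases h : (∑ i ∈ S, Finsupp.single i 1) = m
  · exact mem_image.2 ⟨S, mem_univ _, h⟩
  · exact absurd (if_neg h) hS

/-- **Limits of strongly Rayleigh weights are strongly Rayleigh (or zero)**: `StableOrZero` is preserved under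
pointwise limits of weights on the finite set `2^σ` — BBL §2.2 "this property is preserved by weak convergence
of measures"; the proof is the multivariate Hurwitz theorem (tree `eq_zero_or_isUpperHalfPlaneStable_of_tendsto_coeff`)
applied to the generating polynomials. [cite: BorceaBrandenLiggett2007, §2.2 (before Def. 2.11)] -/
theorem StableOrZero.of_tendsto {ι : Type*} {l : Filter ι} [l.NeBot] {μs : ι → Finset σ → ℝ}
    {μ : Finset σ → ℝ} (hlim : Tendsto μs l (𝓝 μ)) (hs : ∀ i, StableOrZero (μs i)) : StableOrZero μ := by
  classical
  -- generating polynomials with complex coefficients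
  set F : ι → MvPolynomial σ ℂ := fun i => multiAffine fun S => ((μs i S : ℝ) : ℂ) with hF_def
  set p : MvPolynomial σ ℂ := multiAffine fun S => ((μ S : ℝ) : ℂ) with hp_def
  have hcoe : ∀ S, Tendsto (fun i => ((μs i S : ℝ) : ℂ)) l (𝓝 ((μ S : ℝ) : ℂ)) := fun S =>
    (Complex.continuous_ofReal.tendsto _).comp (((continuous_apply S).tendsto μ).comp hlim)
  by_cases hfreq : ∃ᶠ i in l, IsUpperHalfPlaneStable (F i)
  · -- Hurwitz
    set D := (univ : Finset (Finset σ)).image fun S => ∑ i ∈ S, Finsupp.single i 1 with hD_def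
    have key := eq_zero_or_isUpperHalfPlaneStable_of_tendsto_coeff (l := l) (F := F) (p := p) D
      (Eventually.of_forall fun i => support_multiAffine_subset _) (support_multiAffine_subset _)
      (fun m hm => by
        obtain ⟨S, -, rfl⟩ := mem_image.1 hm
        simp only [hF_def, hp_def, coeff_multiAffine_indicator]
        exact hcoe S)
      hfreq
    rcases key with h0 | hst
    · refine Or.inl fun S => ?_
      have := (multiAffine_eq_zero_iff _).1 h0 S
      exact_mod_cast this
    · exact Or.inr ((isUpperHalfPlaneStable_multiAffine_iff _).1 hst)
  · -- eventually zero, hence the limit is zero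
    have hev : ∀ᶠ i in l, μs i = 0 := by
      filter_upwards [not_frequently.1 hfreq] with i hi
      rcases hs i with h0 | hst
      · exact funext h0
      · exact absurd ((isUpperHalfPlaneStable_multiAffine_iff _).2 hst) hi
    have hμ : μ = 0 := by
      have h2 : Tendsto μs l (𝓝 0) := tendsto_const_nhds.congr' (hev.mono fun i hi => hi.symm)
      exact tendsto_nhds_unique hlim h2
    rw [hμ]
    exact stableOrZero_zero

/-- The strongly-Rayleigh-or-zero weights form a closed set. [cite: BorceaBrandenLiggett2007, §2.2 (before
Def. 2.11)] -/
theorem isClosed_setOf_stableOrZero : IsClosed {μ : Finset σ → ℝ | StableOrZero μ} := by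
  refine IsSeqClosed.isClosed ?_
  intro μs μ hs hlim
  exact StableOrZero.of_tendsto hlim hs

end Closed

/-! ## §4 Transpositions of weights and partial symmetrization (Thm. 4.20 for weights) -/

section Swap

variable {σ : Type*} [DecidableEq σ]

/-- The transposition `τ_{a,b}` acting on a weight: `(τ_{a,b} μ)(S) = μ(τ_{a,b}(S))`.
[cite: BorceaBrandenLiggett2007, §2.1 Def. 2.1 (`σ(μ)`), §4.3 (partial symmetrization `τ(μ)`)] -/
def swapWeight (a b : σ) (μ : Finset σ → ℝ) : Finset σ → ℝ := fun S => μ (S.image (Equiv.swap a b))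

/-- Unfolding `swapWeight`. [cite: BorceaBrandenLiggett2007, §4.3] -/
theorem swapWeight_apply (a b : σ) (μ : Finset σ → ℝ) (S : Finset σ) :
    swapWeight a b μ S = μ (S.image (Equiv.swap a b)) := rfl

/-- `τ_{a,b}(τ_{a,b}(S)) = S` (a transposition is an involution). [cite: BorceaBrandenLiggett2007, §5 (the
transposition `τ_{i,j}`)] -/
theorem image_swap_image_swap (a b : σ) (S : Finset σ) :
    (S.image (Equiv.swap a b)).image (Equiv.swap a b) = S := by
  rw [image_image]
  convert image_id (s := S) using 2
  funext x
  simp [Equiv.swap_apply_self]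

/-- `τ_{a,b}` is an involution on weights. [cite: BorceaBrandenLiggett2007, §4.3] -/
theorem swapWeight_swapWeight (a b : σ) (μ : Finset σ → ℝ) : swapWeight a b (swapWeight a b μ) = μ := by
  funext S
  simp only [swapWeight_apply, image_swap_image_swap]

/-- `τ_{a,b}` is additive on weights (`σ(μ)` is linear in `μ`). [cite: BorceaBrandenLiggett2007, §2.1 Def. 2.1] -/
theorem swapWeight_add (a b : σ) (μ ν : Finset σ → ℝ) :
    swapWeight a b (μ + ν) = swapWeight a b μ + swapWeight a b ν := rfl

/-- `τ_{a,b}` commutes with scalars (`σ(μ)` is linear in `μ`). [cite: BorceaBrandenLiggett2007, §2.1 Def. 2.1] -/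
theorem swapWeight_smul (a b : σ) (c : ℝ) (μ : Finset σ → ℝ) :
    swapWeight a b (c • μ) = c • swapWeight a b μ := rfl

/-- `τ_{a,b}` maps measures to measures (nonnegativity). [cite: BorceaBrandenLiggett2007, §2.1 Def. 2.1] -/
theorem swapWeight_nonneg (a b : σ) {μ : Finset σ → ℝ} (h : ∀ S, 0 ≤ μ S) (S : Finset σ) :
    0 ≤ swapWeight a b μ S := h _

/-- `S ↦ τ_{a,b}(S)` as a permutation of `2^σ`. [folklore] -/
private def swapSets (a b : σ) : Equiv.Perm (Finset σ) where
  toFun S := S.image (Equiv.swap a b)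
  invFun S := S.image (Equiv.swap a b)
  left_inv S := image_swap_image_swap a b S
  right_inv S := image_swap_image_swap a b S

/-- **Partial symmetrization of a weight** (BBL §4.3): `μ^{τ,θ} = θ μ + (1 - θ) τ(μ)` for the transposition
`τ = (a b)`. [cite: BorceaBrandenLiggett2007, §4.3 Thm. 4.20 (the measure `μ^{τ,θ}`)] -/
def partialSymmWeight (θ : ℝ) (a b : σ) (μ : Finset σ → ℝ) : Finset σ → ℝ :=
  θ • μ + (1 - θ) • swapWeight a b μ

/-- Unfolding `partialSymmWeight`. [cite: BorceaBrandenLiggett2007, §4.3 Thm. 4.20] -/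
theorem partialSymmWeight_apply (θ : ℝ) (a b : σ) (μ : Finset σ → ℝ) (S : Finset σ) :
    partialSymmWeight θ a b μ S = θ * μ S + (1 - θ) * μ (S.image (Equiv.swap a b)) := rfl

/-- `μ^{τ,θ} ≥ 0` for `μ ≥ 0`, `θ ∈ [0,1]`. [cite: BorceaBrandenLiggett2007, §4.3 Thm. 4.20] -/
theorem partialSymmWeight_nonneg {θ : ℝ} (h0 : 0 ≤ θ) (h1 : θ ≤ 1) (a b : σ) {μ : Finset σ → ℝ}
    (hμ : ∀ S, 0 ≤ μ S) (S : Finset σ) : 0 ≤ partialSymmWeight θ a b μ S := by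
  rw [partialSymmWeight_apply]
  exact add_nonneg (mul_nonneg h0 (hμ _)) (mul_nonneg (sub_nonneg.2 h1) (hμ _))

variable [Fintype σ]

/-- `τ_{a,b}` preserves the total mass. [cite: BorceaBrandenLiggett2007, §4.3] -/
theorem mass_swapWeight (a b : σ) (μ : Finset σ → ℝ) : mass (swapWeight a b μ) = mass μ := by
  rw [mass_def, mass_def]
  exact Fintype.sum_equiv (swapSets a b) _ _ fun S => rfl

omit [DecidableEq σ] in
/-- `multiAffine` is additive in the coefficients. [folklore] -/
private theorem multiAffine_add' {R : Type*} [CommSemiring R] (a b : Finset σ → R) :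
    multiAffine (a + b) = multiAffine a + multiAffine b := by
  simp only [multiAffine, Pi.add_apply, map_add, add_mul, sum_add_distrib]

omit [DecidableEq σ] in
/-- `multiAffine` is homogeneous in the coefficients. [folklore] -/
private theorem multiAffine_smul' {R : Type*} [CommSemiring R] (c : R) (a : Finset σ → R) :
    multiAffine (c • a) = c • multiAffine a := by
  simp only [multiAffine, Pi.smul_apply, smul_eq_mul, map_mul, smul_sum, MvPolynomial.smul_eq_C_mul, mul_assoc]

/-- Renaming the variables of `Σ_S a(S) z^S` along a permutation `e` re-indexes the coefficients:
`Σ_S a(S) z^{e(S)} = Σ_T a(e⁻¹ T) z^T` — the generating polynomial of `σ(μ)` is `g_μ ∘ σ⁻¹` (Def. 2.1: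
"`σ(μ) = μ` for any `σ ∈ 𝔖_n`, or equivalently, its generating polynomial `g_μ` is symmetric").
[cite: BorceaBrandenLiggett2007, §2.1 Def. 2.1] -/
theorem rename_equiv_multiAffine {R : Type*} [CommSemiring R] (e : Equiv.Perm σ) (a : Finset σ → R) :
    MvPolynomial.rename e (multiAffine a) = multiAffine fun T => a (T.image e.symm) := by
  simp only [multiAffine, map_sum, map_mul, MvPolynomial.rename_C, map_prod, MvPolynomial.rename_X]
  refine Fintype.sum_equiv (Equiv.finsetCongr e) _ _ fun S => ?_
  have h1 : (S.image e).image e.symm = S := by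
    rw [image_image]
    convert image_id (s := S) using 2
    funext x; simp
  rw [Equiv.finsetCongr_apply, map_eq_image, Equiv.coe_toEmbedding, h1,
    prod_image fun x _ y _ h => e.injective h]

/-- The generating polynomial of `τ_{a,b} μ` is `g_μ ∘ τ_{a,b}` (complex coefficients).
[cite: BorceaBrandenLiggett2007, §2.1 Def. 2.1 ("`g_μ` is symmetric"), §4.3] -/
theorem multiAffine_swapWeight (a b : σ) (μ : Finset σ → ℝ) :
    multiAffine (fun S => ((swapWeight a b μ S : ℝ) : ℂ)) =
      MvPolynomial.rename (Equiv.swap a b) (multiAffine fun S => ((μ S : ℝ) : ℂ)) := by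
  rw [rename_equiv_multiAffine, Equiv.symm_swap]
  rfl

/-- `μ^{τ,θ}` has the mass of `μ`. [cite: BorceaBrandenLiggett2007, §4.3 Thm. 4.20] -/
theorem mass_partialSymmWeight (θ : ℝ) (a b : σ) (μ : Finset σ → ℝ) :
    mass (partialSymmWeight θ a b μ) = mass μ := by
  have h := mass_swapWeight a b μ
  simp only [mass_def, partialSymmWeight_apply, sum_add_distrib, ← mul_sum] at h ⊢
  simp only [swapWeight_apply] at h
  rw [h]; ring

/-- **Theorem 4.20 for weights.** "The class of strongly Rayleigh measures on `2^{[n]}` is invariant under the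
partial symmetrization procedure": if `μ` is strongly Rayleigh (or zero) then so is `μ^{τ,θ} = θμ + (1-θ)τ(μ)`
for every transposition `τ = (a b)` and `θ ∈ [0,1]` (from the polynomial statement, tree
`IsUpperHalfPlaneStable.partialSymmetrization`). [cite: BorceaBrandenLiggett2007, §4.3 Thm. 4.20] -/
theorem stableOrZero_partialSymmWeight {μ : Finset σ → ℝ} (h : StableOrZero μ) {θ : ℝ} (h0 : 0 ≤ θ)
    (h1 : θ ≤ 1) (a b : σ) : StableOrZero (partialSymmWeight θ a b μ) := by
  rcases h with hz | hst
  · refine Or.inl fun S => ?_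
    rw [partialSymmWeight_apply, hz, hz, mul_zero, mul_zero, add_zero]
  · right
    have hst' : IsUpperHalfPlaneStable (multiAffine fun S => ((μ S : ℝ) : ℂ)) :=
      (isUpperHalfPlaneStable_multiAffine_iff _).2 hst
    have key := hst'.partialSymmetrization (isMultiAffine_multiAffine _) a b h0 h1
    rw [← multiAffine_swapWeight, ← multiAffine_smul', ← multiAffine_smul', ← multiAffine_add'] at key
    have heq : ((θ : ℂ) • fun S => ((μ S : ℝ) : ℂ)) + (1 - (θ : ℂ)) • (fun S => ((swapWeight a b μ S : ℝ) : ℂ)) =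
        fun S => ((partialSymmWeight θ a b μ S : ℝ) : ℂ) := by
      funext S
      simp only [Pi.add_apply, Pi.smul_apply, smul_eq_mul, partialSymmWeight_apply, swapWeight_apply]
      push_cast; ring
    rw [heq] at key
    exact (isUpperHalfPlaneStable_multiAffine_iff _).1 key

end Swap

/-! ## §5 The symmetric exclusion process on `{0,1}^σ`: generator and transition semigroup -/

section Process

variable {σ : Type*} [Fintype σ] [DecidableEq σ]

/-- The transposition `τ_{a,b}` as a (continuous) linear operator on weights. [cite: BorceaBrandenLiggett2007,
§5 (the transposition `τ_{i,j}` applied to `η`)] -/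
def swapOp (a b : σ) : (Finset σ → ℝ) →L[ℝ] (Finset σ → ℝ) :=
  LinearMap.toContinuousLinearMap (LinearMap.funLeft ℝ ℝ fun S : Finset σ => S.image (Equiv.swap a b))

/-- `swapOp a b μ = τ_{a,b} μ`. [cite: BorceaBrandenLiggett2007, §5] -/
@[simp] theorem swapOp_apply (a b : σ) (μ : Finset σ → ℝ) : swapOp a b μ = swapWeight a b μ := rfl

/-- **The pair generator `𝓛_{i,j}`** acting on weights: `(μ 𝓛_{i,j})(S) = ½ q_{i,j} [μ(τ_{i,j} S) - μ(S)]`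
("`𝓛_{i,j} F(η) = ½ q_{i,j} [F(τ_{i,j}(η)) - F(η)]`"; the same formula on functions and on measures since
`τ_{i,j}` is an involution). [cite: BorceaBrandenLiggett2007, §5 proof of Prop. 5.1] -/
def pairGen (q : σ → σ → ℝ) (a b : σ) : (Finset σ → ℝ) →L[ℝ] (Finset σ → ℝ) :=
  (q a b / 2) • (swapOp a b - 1)

/-- Unfolding `pairGen`. [cite: BorceaBrandenLiggett2007, §5 proof of Prop. 5.1] -/
theorem pairGen_apply (q : σ → σ → ℝ) (a b : σ) (μ : Finset σ → ℝ) (S : Finset σ) :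
    pairGen q a b μ S = q a b / 2 * (μ (S.image (Equiv.swap a b)) - μ S) := rfl

/-- **The generator `𝓛 = Σ_{i,j} 𝓛_{i,j}`** of the symmetric exclusion process with rates `q`, acting on weights
(sum over ordered pairs, as printed). [cite: BorceaBrandenLiggett2007, §5 proof of Prop. 5.1] -/
def excGen (q : σ → σ → ℝ) : (Finset σ → ℝ) →L[ℝ] (Finset σ → ℝ) := ∑ p : σ × σ, pairGen q p.1 p.2

/-- `excGen q = Σ_i Σ_j 𝓛_{i,j}`. [cite: BorceaBrandenLiggett2007, §5 proof of Prop. 5.1] -/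
theorem excGen_eq_sum (q : σ → σ → ℝ) : excGen q = ∑ a, ∑ b, pairGen q a b := by
  rw [excGen, Fintype.sum_prod_type]

/-- `(μ𝓛)(S) = Σ_i Σ_j ½ q_{i,j} [μ(τ_{i,j} S) - μ(S)]`. [cite: BorceaBrandenLiggett2007, §5 proof of Prop. 5.1] -/
theorem excGen_apply (q : σ → σ → ℝ) (μ : Finset σ → ℝ) (S : Finset σ) :
    excGen q μ S = ∑ a, ∑ b, q a b / 2 * (μ (S.image (Equiv.swap a b)) - μ S) := by
  simp only [excGen_eq_sum, _root_.sum_apply, Finset.sum_apply, pairGen_apply]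

/-- **The distribution of `η_t`**: for an initial weight `μ` (the law of `η_0`), `sepLaw q t μ = μ T(t)` with
`T(t) = e^{t𝓛}` the transition semigroup of the finite symmetric exclusion process with rates `q`.
[cite: BorceaBrandenLiggett2007, §5 proof of Prop. 5.1 (semigroup `T(t)` with generator `𝓛`)]
[cite: Liggett1985, Ch. VIII (the symmetric exclusion process)] -/
def sepLaw (q : σ → σ → ℝ) (t : ℝ) (μ : Finset σ → ℝ) : Finset σ → ℝ :=
  (exp (t • excGen q) : (Finset σ → ℝ) →L[ℝ] (Finset σ → ℝ)) μ

/-- Unfolding `sepLaw`. [cite: BorceaBrandenLiggett2007, §5 proof of Prop. 5.1] -/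
theorem sepLaw_def (q : σ → σ → ℝ) (t : ℝ) (μ : Finset σ → ℝ) :
    sepLaw q t μ = (exp (t • excGen q) : (Finset σ → ℝ) →L[ℝ] (Finset σ → ℝ)) μ := rfl

/-- `T(0) = 1`. [cite: BorceaBrandenLiggett2007, §5 proof of Prop. 5.1] -/
theorem sepLaw_zero (q : σ → σ → ℝ) (μ : Finset σ → ℝ) : sepLaw q 0 μ = μ := by
  simp [sepLaw_def]

/-- The semigroup law `T(s + t) = T(s) T(t)` (`T(s)` and `T(t)` commute). [cite: BorceaBrandenLiggett2007, §5
proof of Prop. 5.1 (the semigroup `T(t)`)] -/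
theorem sepLaw_add (q : σ → σ → ℝ) (s t : ℝ) (μ : Finset σ → ℝ) :
    sepLaw q (s + t) μ = sepLaw q s (sepLaw q t μ) := by
  letI : NormedAlgebra ℚ ((Finset σ → ℝ) →L[ℝ] (Finset σ → ℝ)) :=
    NormedAlgebra.restrictScalars ℚ ℝ ((Finset σ → ℝ) →L[ℝ] (Finset σ → ℝ))
  have hc : Commute (s • excGen q) (t • excGen q) := ((Commute.refl _).smul_left _).smul_right _
  rw [sepLaw_def, sepLaw_def, sepLaw_def, add_smul, exp_add_of_commute hc, mul_apply_eq_comp]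

/-- **Kolmogorov's forward equation** `d/dt (μ T(t)) = (μ T(t)) 𝓛` — the law `sepLaw q · μ` is the solution of
the evolution equation of the process started from `μ`. [cite: BorceaBrandenLiggett2007, §5 proof of Prop. 5.1
(generator `𝓛` of `T(t)`)] [cite: Liggett1985, Ch. VIII] -/
theorem hasDerivAt_sepLaw (q : σ → σ → ℝ) (μ : Finset σ → ℝ) (t : ℝ) :
    HasDerivAt (fun s => sepLaw q s μ) (excGen q (sepLaw q t μ)) t := by
  have h1 : HasDerivAt (fun s : ℝ => (exp (s • excGen q) : (Finset σ → ℝ) →L[ℝ] (Finset σ → ℝ)))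
      (excGen q * exp (t • excGen q)) t := hasDerivAt_exp_smul_const' (𝕂 := ℝ) (excGen q) t
  have h2 := h1.clm_apply (hasDerivAt_const t μ)
  simp only [map_zero, add_zero, mul_apply_eq_comp] at h2
  exact h2

/-- **BBL's reduction, Euler form: a closed class of weights preserved by every partial symmetrization
`ν ↦ ν^{τ,θ}` (`τ` a transposition, `θ ∈ [0,1]`) is preserved by the exclusion semigroup** `μ ↦ μ T(t)`,
`t ≥ 0`, for nonnegative rates ("if a closed set of probability measures `𝓜` has the property that `μ ∈ 𝓜`
implies `μ T_i(t) ∈ 𝓜` […] then `μ ∈ 𝓜` implies `μ T(t) ∈ 𝓜`"; here the Euler factor `1 + s 𝓛_{i,j}` is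
the partial symmetrization with `θ = 1 - s q_{i,j}/2`). [cite: BorceaBrandenLiggett2007, §5 proof of Prop. 5.1] -/
theorem sepLaw_mem_of_isClosed {M : Set (Finset σ → ℝ)} (hM : IsClosed M)
    (h : ∀ (a b : σ) (θ : ℝ), 0 ≤ θ → θ ≤ 1 → ∀ ν ∈ M, partialSymmWeight θ a b ν ∈ M) {q : σ → σ → ℝ}
    (hq : ∀ a b, 0 ≤ q a b) {t : ℝ} (ht : 0 ≤ t) {μ : Finset σ → ℝ} (hμ : μ ∈ M) : sepLaw q t μ ∈ M := by
  -- the generator as the sum of a list of pair generators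
  set l : List ((Finset σ → ℝ) →L[ℝ] (Finset σ → ℝ)) :=
    (univ : Finset (σ × σ)).toList.map fun p => pairGen q p.1 p.2 with hl_def
  have hsum : l.sum = excGen q := by rw [hl_def, sum_map_toList]; rfl
  -- a uniform admissible step size
  set Q : ℝ := ∑ p : σ × σ, q p.1 p.2 with hQ_def
  have hQ0 : 0 ≤ Q := sum_nonneg fun p _ => hq p.1 p.2
  have hqQ : ∀ a b, q a b ≤ Q + 1 := fun a b =>
    (single_le_sum (f := fun p : σ × σ => q p.1 p.2) (fun p _ => hq p.1 p.2) (mem_univ (a, b))).trans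
      (le_add_of_nonneg_right zero_le_one)
  have hQ1 : 0 < Q + 1 := by linarith
  have hε : 0 < 2 / (Q + 1) := div_pos two_pos hQ1
  have key := mapsTo_exp_smul_sum_of_isClosed hM l hε (fun L hL s hs0 hsε => ?_) ht
  · rw [hsum] at key
    exact key hμ
  -- each Euler step `1 + s 𝓛_{a,b}` is a partial symmetrization
  obtain ⟨p, -, rfl⟩ := List.mem_map.1 hL
  intro ν hν
  set θ : ℝ := 1 - s * (q p.1 p.2 / 2) with hθ_def
  have hθ1 : θ ≤ 1 := by
    rw [hθ_def]
    exact sub_le_self _ (mul_nonneg hs0 (div_nonneg (hq p.1 p.2) zero_le_two))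
  have hθ0 : 0 ≤ θ := by
    rw [hθ_def, sub_nonneg]
    calc s * (q p.1 p.2 / 2) ≤ 2 / (Q + 1) * ((Q + 1) / 2) :=
          mul_le_mul hsε (by linarith [hqQ p.1 p.2]) (div_nonneg (hq p.1 p.2) zero_le_two) hε.le
      _ = 1 := by field_simp
  have heq : ((1 : (Finset σ → ℝ) →L[ℝ] (Finset σ → ℝ)) + s • pairGen q p.1 p.2) ν =
      partialSymmWeight θ p.1 p.2 ν := by
    funext S
    have h1 : (((1 : (Finset σ → ℝ) →L[ℝ] (Finset σ → ℝ)) + s • pairGen q p.1 p.2) ν) S =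
        ν S + s * pairGen q p.1 p.2 ν S := rfl
    rw [h1, pairGen_apply, partialSymmWeight_apply, hθ_def]
    ring
  rw [heq]
  exact h _ _ _ hθ0 hθ1 ν hν

/-- The exclusion semigroup preserves nonnegativity: `μ ≥ 0 ⟹ μ T(t) ≥ 0` (`t ≥ 0`, rates `≥ 0`).
[cite: BorceaBrandenLiggett2007, §5 proof of Prop. 5.1 (`T(t)` maps probability measures to probability
measures)] -/
theorem sepLaw_nonneg {q : σ → σ → ℝ} (hq : ∀ a b, 0 ≤ q a b) {t : ℝ} (ht : 0 ≤ t) {μ : Finset σ → ℝ}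
    (hμ : ∀ S, 0 ≤ μ S) (S : Finset σ) : 0 ≤ sepLaw q t μ S := by
  have hM : IsClosed {ν : Finset σ → ℝ | ∀ S, 0 ≤ ν S} := by
    rw [Set.setOf_forall]
    exact isClosed_iInter fun S => isClosed_le continuous_const (continuous_apply S)
  exact sepLaw_mem_of_isClosed hM (fun a b θ h0 h1 ν hν S => partialSymmWeight_nonneg h0 h1 a b hν S)
    hq ht (μ := μ) hμ S

omit [DecidableEq σ] in
/-- Total mass is continuous in the weight. [folklore] -/
private theorem continuous_mass : Continuous fun ν : Finset σ → ℝ => mass ν := by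
  simp only [mass_def]
  exact continuous_finsetSum _ fun S _ => continuous_apply S

/-- The exclusion semigroup preserves the total mass: `(μ T(t))(Ω) = μ(Ω)`.
[cite: BorceaBrandenLiggett2007, §5 proof of Prop. 5.1 (`T(t)` maps probability measures to probability
measures)] -/
theorem mass_sepLaw {q : σ → σ → ℝ} (hq : ∀ a b, 0 ≤ q a b) {t : ℝ} (ht : 0 ≤ t) (μ : Finset σ → ℝ) :
    mass (sepLaw q t μ) = mass μ := by
  have hM : IsClosed {ν : Finset σ → ℝ | mass ν = mass μ} := isClosed_eq continuous_mass continuous_const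
  exact sepLaw_mem_of_isClosed hM (fun a b θ _ _ ν hν => by
    simp only [Set.mem_setOf_eq] at hν ⊢; rw [mass_partialSymmWeight, hν]) hq ht (μ := μ) rfl

end Process

/-! ## §6 Proposition 5.1, Theorem 5.2 (finite `S`), Remark 5.1 and (5.2)–(5.4) -/

section Main

variable {σ : Type*} [Fintype σ] [DecidableEq σ]

/-- **Borcea–Brändén–Liggett, Proposition 5.1.** "Suppose that `S` is finite and the initial distribution `η_0`
of a symmetric exclusion process on `{0,1}^S` is strongly Rayleigh. Then so is the distribution of `η_t` for all
`t > 0`": `StableOrZero μ ⟹ StableOrZero (μ T(t))` (`t ≥ 0`, rates `≥ 0`). Proof: the strongly Rayleigh class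
is closed (`isClosed_setOf_stableOrZero`) and preserved by partial symmetrizations (Thm. 4.20,
`stableOrZero_partialSymmWeight`), hence by `T(t)` (`sepLaw_mem_of_isClosed`).
[cite: BorceaBrandenLiggett2007, §5 Prop. 5.1] -/
theorem stableOrZero_sepLaw {μ : Finset σ → ℝ} (h : StableOrZero μ) {q : σ → σ → ℝ}
    (hq : ∀ a b, 0 ≤ q a b) {t : ℝ} (ht : 0 ≤ t) : StableOrZero (sepLaw q t μ) :=
  sepLaw_mem_of_isClosed isClosed_setOf_stableOrZero
    (fun a b _ h0 h1 _ hν => stableOrZero_partialSymmWeight hν h0 h1 a b) hq ht (μ := μ) h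

/-- **Borcea–Brändén–Liggett, Theorem 5.2 (finite `S`).** "Suppose […] the initial distribution `η_0` of a
symmetric exclusion process on `{0,1}^S` is strongly Rayleigh. Then the distribution of `η_t` is strongly
Rayleigh, and hence CNA+, for all `t > 0`" — CNA+ by Thm. 4.9 (tree `StableOrZero.isCNAPlus`).
[cite: BorceaBrandenLiggett2007, §5 Thm. 5.2] -/
theorem isCNAPlus_sepLaw {μ : Finset σ → ℝ} (h : StableOrZero μ) (hμ : ∀ S, 0 ≤ μ S) {q : σ → σ → ℝ}
    (hq : ∀ a b, 0 ≤ q a b) {t : ℝ} (ht : 0 ≤ t) : IsCNAPlus (sepLaw q t μ) :=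
  (stableOrZero_sepLaw h hq ht).isCNAPlus (sepLaw_nonneg hq ht hμ)

/-- Theorem 5.2, NA form: the distribution of `η_t` is negatively associated (CNA+ ⟹ CNA ⟹ NA).
[cite: BorceaBrandenLiggett2007, §5 Thm. 5.2, §2.1 Def. 2.7] -/
theorem isNegAssoc_sepLaw {μ : Finset σ → ℝ} (h : StableOrZero μ) (hμ : ∀ S, 0 ≤ μ S) {q : σ → σ → ℝ}
    (hq : ∀ a b, 0 ≤ q a b) {t : ℝ} (ht : 0 ≤ t) : IsNegAssoc (sepLaw q t μ) :=
  ((isCNAPlus_sepLaw h hμ hq ht).isCNA).isNegAssoc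

/-- **Deterministic initial configurations are strongly Rayleigh**: the point mass at `η` has generating
polynomial `z^η`, which does not vanish on `ℋ^σ`. [cite: BorceaBrandenLiggett2007, §5 Remark 5.1 (any product
measure is obviously strongly Rayleigh)] -/
theorem stableOrZero_dirac (η : Finset σ) : StableOrZero (fun S : Finset σ => if S = η then (1 : ℝ) else 0) := by
  refine Or.inr fun z hz => ?_
  have h1 : (∑ S : Finset σ, ((if S = η then (1 : ℝ) else 0 : ℝ) : ℂ) * ∏ i ∈ S, z i) = ∏ i ∈ η, z i := by
    rw [sum_eq_single η]
    · simp
    · intro S _ hS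
      simp [hS]
    · intro h
      exact absurd (mem_univ η) h
  rw [h1]
  exact prod_ne_zero_iff.2 fun i _ hzi => (hz i).ne' (by rw [hzi, Complex.zero_im])

/-- The point mass at `η` (deterministic initial configuration) is a probability weight.
[cite: BorceaBrandenLiggett2007, §5 ("the process with initial configuration `η`"), Remark 5.1] -/
theorem mass_dirac (η : Finset σ) : mass (fun S : Finset σ => if S = η then (1 : ℝ) else 0) = 1 := by
  simp [mass_def]

/-- **The product measure `ν_α`** on `{0,1}^σ` with marginals `α(i) ∈ [0,1]`:
`ν_α(S) = Π_{i ∈ S} α(i) Π_{i ∉ S} (1 - α(i))` ("`ν_α{η : η ≡ 1 on A} = Π_{i ∈ A} α(i)`").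
[cite: BorceaBrandenLiggett2007, §5 (b) after Remark 5.1 (the product measure `ν_α`), §2.3 Def. 2.13 (product
measures)] -/
def productWeight (α : σ → ℝ) : Finset σ → ℝ := fun S => (∏ i ∈ S, α i) * ∏ i ∈ Sᶜ, (1 - α i)

/-- Unfolding `productWeight`. [cite: BorceaBrandenLiggett2007, §5 (b) after Remark 5.1] -/
theorem productWeight_apply (α : σ → ℝ) (S : Finset σ) :
    productWeight α S = (∏ i ∈ S, α i) * ∏ i ∈ Sᶜ, (1 - α i) := rfl

/-- `ν_α ≥ 0` for `α ∈ [0,1]^σ`. [cite: BorceaBrandenLiggett2007, §5 (b) after Remark 5.1] -/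
theorem productWeight_nonneg {α : σ → ℝ} (h0 : ∀ i, 0 ≤ α i) (h1 : ∀ i, α i ≤ 1) (S : Finset σ) :
    0 ≤ productWeight α S :=
  mul_nonneg (prod_nonneg fun i _ => h0 i) (prod_nonneg fun i _ => sub_nonneg.2 (h1 i))

/-- The generating polynomial of `ν_α` factors: `Σ_S ν_α(S) z^S = Π_i (α(i) z_i + (1 - α(i)))`.
[cite: BorceaBrandenLiggett2007, §2.3 Def. 2.13 (product measures have product generating polynomials)] -/
theorem sum_productWeight_mul_prod (α : σ → ℝ) (z : σ → ℂ) :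
    (∑ S : Finset σ, ((productWeight α S : ℝ) : ℂ) * ∏ i ∈ S, z i) =
      ∏ i, ((α i : ℂ) * z i + ((1 - α i : ℝ) : ℂ)) := by
  rw [prod_add, powerset_univ]
  refine sum_congr rfl fun S _ => ?_
  rw [productWeight_apply, prod_mul_distrib, compl_eq_univ_sdiff]
  push_cast
  ring

/-- **Product measures are strongly Rayleigh** (Remark 5.1: "any such measure is obviously strongly Rayleigh"):
each factor `α(i) z_i + (1 - α(i))`, `α(i) ≥ 0`, is `1` or has its zero on the real axis.
[cite: BorceaBrandenLiggett2007, §5 Remark 5.1, §2.3 Def. 2.13] -/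
theorem stableOrZero_productWeight {α : σ → ℝ} (h0 : ∀ i, 0 ≤ α i) : StableOrZero (productWeight α) := by
  refine Or.inr fun z hz => ?_
  rw [sum_productWeight_mul_prod]
  refine prod_ne_zero_iff.2 fun i _ h => ?_
  have him : ((α i : ℂ) * z i + ((1 - α i : ℝ) : ℂ)).im = α i * (z i).im := by
    simp [Complex.add_im, Complex.mul_im, Complex.ofReal_im, Complex.ofReal_re]
  rcases (h0 i).eq_or_lt with hα | hα
  · rw [← hα] at h
    norm_num at h
  · have : 0 < ((α i : ℂ) * z i + ((1 - α i : ℝ) : ℂ)).im := by rw [him]; exact mul_pos hα (hz i)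
    rw [h, Complex.zero_im] at this
    exact lt_irrefl _ this

omit [Fintype σ] in
/-- The occupation indicator `𝟙{η_t ≡ 1 on A} = 𝟙{A ⊆ S}` is increasing. [folklore] -/
private theorem monotone_indicator_supset (A : Finset σ) :
    Monotone (fun S : Finset σ => if A ⊆ S then (1 : ℝ) else 0) := by
  intro S T hST
  dsimp only
  by_cases hA : A ⊆ S
  · rw [if_pos hA, if_pos (hA.trans hST)]
  · rw [if_neg hA]; split_ifs <;> norm_num

omit [Fintype σ] in
/-- … and determined by `A`. [folklore] -/
private theorem determinedBy_indicator_supset (A : Finset σ) :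
    DeterminedBy (fun S : Finset σ => if A ⊆ S then (1 : ℝ) else 0) A := by
  intro S T hST
  have h : A ⊆ S ↔ A ⊆ T := by
    rw [← inter_eq_right, ← inter_eq_right, hST]
  simp only [h]

omit [Fintype σ] in
/-- The vacancy indicator `𝟙{η_t ≡ 0 on B} = 𝟙{S ∩ B = ∅}` is decreasing. [folklore] -/
private theorem antitone_indicator_disjoint (B : Finset σ) :
    Antitone (fun S : Finset σ => if Disjoint S B then (1 : ℝ) else 0) := by
  intro S T hST
  dsimp only
  by_cases hT : Disjoint T B
  · rw [if_pos hT, if_pos (disjoint_of_subset_left hST hT)]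
  · rw [if_neg hT]; split_ifs <;> norm_num

omit [Fintype σ] in
/-- … and determined by `B`. [folklore] -/
private theorem determinedBy_indicator_disjoint (B : Finset σ) :
    DeterminedBy (fun S : Finset σ => if Disjoint S B then (1 : ℝ) else 0) B := by
  intro S T hST
  have h : Disjoint S B ↔ Disjoint T B := by
    rw [disjoint_iff_inter_eq_empty, disjoint_iff_inter_eq_empty, hST]
  simp only [h]

omit [DecidableEq σ] in
/-- `E_ν 𝟙{P}` is the `ν`-mass of `{S : P S}`. [folklore] -/
private theorem ex_indicator (ν : Finset σ → ℝ) (P : Finset σ → Prop) [DecidablePred P] :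
    ex ν (fun S => if P S then (1 : ℝ) else 0) = ∑ S ∈ univ.filter P, ν S := by
  rw [ex_def, sum_filter]
  exact sum_congr rfl fun S _ => by split_ifs <;> simp

/-- **(5.4), Liggett's conjecture, for any strongly Rayleigh initial distribution**: for disjoint `A, B ⊆ S`
and `ν` the distribution of `η_t`,
`ν(η ≡ 1 on A, η ≡ 0 on B) · ν(Ω) ≥ ν(η ≡ 1 on A) · ν(η ≡ 0 on B)` (one event increasing, the other
decreasing; negative association, Thm. 5.2). [cite: BorceaBrandenLiggett2007, §5 (5.4), Thm. 5.2, Remark 5.1] -/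
theorem BorceaBrandenLiggett_eq_5_4 {μ : Finset σ → ℝ} (h : StableOrZero μ) (hμ : ∀ S, 0 ≤ μ S)
    {q : σ → σ → ℝ} (hq : ∀ a b, 0 ≤ q a b) {t : ℝ} (ht : 0 ≤ t) {A B : Finset σ} (hAB : Disjoint A B) :
    (∑ S ∈ univ.filter (fun S : Finset σ => A ⊆ S), sepLaw q t μ S) *
        (∑ S ∈ univ.filter (fun S : Finset σ => Disjoint S B), sepLaw q t μ S) ≤
      (∑ S ∈ univ.filter (fun S : Finset σ => A ⊆ S ∧ Disjoint S B), sepLaw q t μ S) * mass (sepLaw q t μ) := by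
  have key := (isNegAssoc_sepLaw h hμ hq ht).monotone_antitone (monotone_indicator_supset A)
    (antitone_indicator_disjoint B) (determinedBy_indicator_supset A) (determinedBy_indicator_disjoint B) hAB
  rw [ex_indicator, ex_indicator] at key
  have hFG : ((fun S : Finset σ => if A ⊆ S then (1 : ℝ) else 0) * fun S => if Disjoint S B then (1 : ℝ) else 0) =
      fun S => if A ⊆ S ∧ Disjoint S B then (1 : ℝ) else 0 := by
    funext S
    simp only [Pi.mul_apply]
    by_cases hA : A ⊆ S <;> by_cases hB : Disjoint S B <;> simp [hA, hB]
  rw [hFG, ex_indicator] at key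
  exact key

/-- **(5.4) as printed (deterministic initial configuration `η`)**: with `ν = δ_η T(t)` (a probability weight),
`P^η(η_t ≡ 1 on A, η_t ≡ 0 on B) ≥ P^η(η_t ≡ 1 on A) P^η(η_t ≡ 0 on B)` for disjoint `A, B`.
[cite: BorceaBrandenLiggett2007, §5 (5.4), Remark 5.1] -/
theorem BorceaBrandenLiggett_eq_5_4_dirac (η : Finset σ) {q : σ → σ → ℝ} (hq : ∀ a b, 0 ≤ q a b) {t : ℝ}
    (ht : 0 ≤ t) {A B : Finset σ} (hAB : Disjoint A B) :
    (∑ S ∈ univ.filter (fun S : Finset σ => A ⊆ S),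
        sepLaw q t (fun S : Finset σ => if S = η then (1 : ℝ) else 0) S) *
        (∑ S ∈ univ.filter (fun S : Finset σ => Disjoint S B),
          sepLaw q t (fun S : Finset σ => if S = η then (1 : ℝ) else 0) S) ≤
      ∑ S ∈ univ.filter (fun S : Finset σ => A ⊆ S ∧ Disjoint S B),
        sepLaw q t (fun S : Finset σ => if S = η then (1 : ℝ) else 0) S := by
  have key := BorceaBrandenLiggett_eq_5_4 (stableOrZero_dirac η) (fun S => by positivity) hq ht hAB
  rwa [mass_sepLaw hq ht, mass_dirac, mul_one] at key

/-- **(5.3), Andjel's inequality, for any strongly Rayleigh initial distribution**: for disjoint `A, B` and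
`ν` the distribution of `η_t`, `ν(η ≡ 1 on A ∪ B) · ν(Ω) ≤ ν(η ≡ 1 on A) · ν(η ≡ 1 on B)` (both events
increasing; negative association). [cite: BorceaBrandenLiggett2007, §5 (5.3), Thm. 5.2] [cite: Andjel1988,
Theorem (correlation inequality for the symmetric exclusion process)] -/
theorem BorceaBrandenLiggett_eq_5_3 {μ : Finset σ → ℝ} (h : StableOrZero μ) (hμ : ∀ S, 0 ≤ μ S)
    {q : σ → σ → ℝ} (hq : ∀ a b, 0 ≤ q a b) {t : ℝ} (ht : 0 ≤ t) {A B : Finset σ} (hAB : Disjoint A B) :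
    (∑ S ∈ univ.filter (fun S : Finset σ => A ∪ B ⊆ S), sepLaw q t μ S) * mass (sepLaw q t μ) ≤
      (∑ S ∈ univ.filter (fun S : Finset σ => A ⊆ S), sepLaw q t μ S) *
        ∑ S ∈ univ.filter (fun S : Finset σ => B ⊆ S), sepLaw q t μ S := by
  have key := isNegAssoc_sepLaw h hμ hq ht (monotone_indicator_supset A) (monotone_indicator_supset B)
    (determinedBy_indicator_supset A) (determinedBy_indicator_supset B) hAB
  rw [ex_indicator, ex_indicator] at key
  have hFG : ((fun S : Finset σ => if A ⊆ S then (1 : ℝ) else 0) * fun S => if B ⊆ S then (1 : ℝ) else 0) =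
      fun S => if A ∪ B ⊆ S then (1 : ℝ) else 0 := by
    funext S
    simp only [Pi.mul_apply, union_subset_iff]
    by_cases hA : A ⊆ S <;> by_cases hB : B ⊆ S <;> simp [hA, hB]
  rw [hFG, ex_indicator] at key
  exact key

/-- **(5.2), Liggett's inequality [L0, Prop. VIII.1.7], for any strongly Rayleigh initial probability
distribution**: `ν(η ≡ 1 on A) ≤ Π_{i ∈ A} ν(η(i) = 1)` for `ν = μ T(t)` with `μ(Ω) = 1` (induction on `A`
with (5.3)). [cite: BorceaBrandenLiggett2007, §5 (5.2), Thm. 5.2] [cite: Liggett1985, Ch. VIII Prop. 1.7] -/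
theorem BorceaBrandenLiggett_eq_5_2 {μ : Finset σ → ℝ} (h : StableOrZero μ) (hμ : ∀ S, 0 ≤ μ S)
    (hmass : mass μ = 1) {q : σ → σ → ℝ} (hq : ∀ a b, 0 ≤ q a b) {t : ℝ} (ht : 0 ≤ t) (A : Finset σ) :
    (∑ S ∈ univ.filter (fun S : Finset σ => A ⊆ S), sepLaw q t μ S) ≤
      ∏ i ∈ A, ∑ S ∈ univ.filter (fun S : Finset σ => i ∈ S), sepLaw q t μ S := by
  have hm : mass (sepLaw q t μ) = 1 := by rw [mass_sepLaw hq ht, hmass]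
  induction A using Finset.induction_on with
  | empty =>
    have h1 : (univ.filter fun S : Finset σ => (∅ : Finset σ) ⊆ S) = univ :=
      filter_true_of_mem fun S _ => empty_subset S
    rw [h1, prod_empty, ← mass_def, hm]
  | insert i A hi ih =>
    rw [prod_insert hi]
    have hdisj : Disjoint ({i} : Finset σ) A := disjoint_singleton_left.2 hi
    have key := BorceaBrandenLiggett_eq_5_3 h hμ hq ht hdisj
    rw [hm, mul_one] at key
    have hins : ∀ S : Finset σ, insert i A ⊆ S ↔ {i} ∪ A ⊆ S := fun S => by rw [insert_eq]
    simp only [hins]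
    refine key.trans ?_
    have hsing : ∀ S : Finset σ, ({i} : Finset σ) ⊆ S ↔ i ∈ S := fun S => singleton_subset_iff
    simp only [hsing]
    exact mul_le_mul_of_nonneg_left ih (sum_nonneg fun S _ => sepLaw_nonneg hq ht hμ S)

/-- **(5.2) as printed**: `P^η(η_t ≡ 1 on A) ≤ Π_{i ∈ A} P^η(η_t(i) = 1)` for a deterministic initial
configuration `η`. [cite: BorceaBrandenLiggett2007, §5 (5.2)] [cite: Liggett1985, Ch. VIII Prop. 1.7] -/
theorem BorceaBrandenLiggett_eq_5_2_dirac (η : Finset σ) {q : σ → σ → ℝ} (hq : ∀ a b, 0 ≤ q a b) {t : ℝ}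
    (ht : 0 ≤ t) (A : Finset σ) :
    (∑ S ∈ univ.filter (fun S : Finset σ => A ⊆ S),
        sepLaw q t (fun S : Finset σ => if S = η then (1 : ℝ) else 0) S) ≤
      ∏ i ∈ A, ∑ S ∈ univ.filter (fun S : Finset σ => i ∈ S),
        sepLaw q t (fun S : Finset σ => if S = η then (1 : ℝ) else 0) S :=
  BorceaBrandenLiggett_eq_5_2 (stableOrZero_dirac η) (fun S => by positivity) (mass_dirac η) hq ht A

end Main

end Literature.Probability.NegativeDependence
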